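import Literature.MathematicalPhysics.QuantumFieldTheory.Balaban1983to89.B9Eq326LocalPartTowerDivergenceRow
import Literature.MathematicalPhysics.QuantumFieldTheory.Balaban1983to89.B9Eq342GradientRowComparisonMassUniform

/-!
# `Balaban1983to89.B9Eq326LocalPartTowerDivergenceRowDiagonalClosed` — T. Bałaban, *Propagators for lattice gauge theories in a background field*, Commun.
# Math. Phys. **99** (1985) 389–434 [Balaban1985BackgroundPropagators] Thm 3.1 (3.42) p. 397 SECOND ENTRY («δ₀, B₀ dependent on d and L only») read for the LOCAL
# PART `A₀ = Δ(U) + D_UD*_U + Q*aQ` of (3.26) p. 395 in its divergence form, (3.8) p. 392, (3.35) p. 396, (3.49) p. 399, with [Balaban1985Variational] (134)–(136)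
# p. 298: **THE DIVERGENCE ROW OF THE TOWER LOCAL PART, FULLY CLOSED ON PRINT's DIAGONAL — `∃ (α₁, B, δ)` BEFORE `∀ n η c₀ c₁ m U …`: for
# `A₀,k = Δ(U) + D_UD*_U + Q_k(U)†(a•Q_k(U))` on the bonds of `T_{(L^{n+1}m)}`, every source `f` supported over the bonds of ONE unit block `v` with `‖f(b)‖ ≤ F`
# and every fine site `y`: `‖(D*_U A₀,k⁻¹ f)(y)‖ ≤ B·e^{−δ·d_m(Πy, v)}·F`, `(α₁, B, δ)` depending on `(d, L, M_φ, M_φ′, M_τ, ρ_w, a, a′, ϱ, A_Q)` ALONE** — this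
# lineage's (DVT) `B9Eq326LocalPartTowerDivergenceRow` §2 with its displayed value row inhabited by (ECL)
# `B9Eq326LocalPartTowerSupDecayDiagonalClosed.exists_sup_decay_localInvK_diagonal_closed` and every storey-J letter read on the diagonal exactly as the NE9
# OWNER t4-ne9-p1's `B9Eq342GreenPrimeTowerGradientRowDiagonal` reads the site twin (the `∃`-first shape of beta-an4's INTERFACE REQUEST D4, `∀`-block = (ECL)'s
# + the bond-gradient datum `hUgrad`)

statement-level skeleton of published theorems with citation tags; proofs where landed; nothing here is a claim about the Yang–Mills mass gap

CITATION HEADER (lean-in-tree rule).  Audit cell `pub-balaban`, sub-cell `t4`, BINDER row NE9; filed by NE9 crux-team LEAF PROVER 03 (`b2b-balaban-t4-ne9-formalise-leaf-03`,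
gen 79; road ΔA-CT).  Imports this lineage's (DVT) (through it (TZC), (ECL), the OWNER's (GT), ne9-leaf-05's (K48)) and ne9-leaf-05's (K37)
`B9Eq342GradientRowComparisonMassUniform`.  SOURCE READ first-hand in the held text layer [Balaban1985BackgroundPropagators]
(`paper:balaban1985-cmp99-background-propagators`, journal page = PDF page + 388): p. 397 Thm 3.1 *«There exist positive constants M₁, δ₀, α₀, B₀ dependent on d
and L only …»*, (3.42) second member; p. 396 (3.35) (`|A| < O(1)Mα₀(L^jη)⁻¹`, `|∇^ηA| < O(1)Mα₀(L^jη)⁻²` — the cell's `‖U(b) − 1‖ ≤ αη`, `‖U(x,μ) − U(x−e_μ,μ)‖ ≤ αη²`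
in the identity gauge at `L^jη = 1`); p. 395 (3.26); p. 392 (3.8); p. 399 (3.49).  Print's random-walk proof (pp. 398–409) is NOT reproduced; [folklore] composition BY
NAME plus real arithmetic; nothing printed is a hypothesis except the model letters; the `[cite: …]` tags are TEXT LOCATIONS.

WHAT IS PROVED (sorry-free; proof lane — 0 `def`).  §1 private real-arithmetic letters.  §2 **`exists_divergence_row_localInvK_diagonal_closed`** (docstring).  Choices:
`(α₁, B_E, δ_E)` := (ECL)'s triple; site rate `θ := δ_Eη` (so (DVT)'s `κ ≤ θL^{n+1}` holds with `κ := δ := δ_E`); `ε_t := αη`, `a_U := αη²`, plaquette letters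
`δ := αη²` (`B9Ineq369CurvatureSmall.norm_reHol_sub_one_le` ∕ `norm_imHol_le`); (T) by `norm_adTransportW_eq` ∕ `_inv_eq`; comparison mass
`m_c := max(2, 4d(cosh δ_E − 1), (2(2M_φM_φ′α₁)(e^{δ_E}+1)d(3√2 + 4 sinh δ_E))²)` so that BOTH t-free windows hold for every `α ≤ α₁` (no further smallness);
`β := 2 sinh θ∕(m_c − 2dη⁻²(cosh θ − 1))` (`b∕β ≤ M_φM_φ′α₁m_c∕δ_E` by `sinh θ ≥ θ`), `κ′ := δ_E`, `C := C_W(m_c, δ_E, 1)`, `K := C√m_c` ((K37)); the readings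
`|η⁻¹|·αη = α`, `p_K ≤ 768|DirPair d|M_τM_φ²ρ_wα₁`, `η⁻²(d−1)δ_𝒦 = 4(d−1)M_φM_φ′α`, `e^{2θ}, e^{θd(2L^{n+1}−1)} ≤ e^{2dδ_E}`, `√(c₀·d·(L^{n+1})^d) = √d·√c₁`,
`e^{θ(L^{n+1}−1)} ≤ e^{δ_E}`, `η⁻¹ΣB_ν ≤ dC₁`, `C₁ = (3√2 + 4 sinh δ_E)∕√m_c`.  The `set_option maxHeartbeats 400000` covers the size of the displayed closed form of (DVT) §2
(as in (ECL) ∕ (GTD)); §1's letters are read off the goal by a linear pattern, so no supplier's display is re-spelled here.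
HONEST SCOPE.  Composition + bookkeeping; constants crude; the MODEL letters (`star U = U⁻¹`, `U(b) ∈ U1`, `‖U(b) − 1‖ ≤ αη`, plaquettes `≤ αη²`, the bond-gradient
datum `≤ αη²` — NOT derivable from the others, cf. the OWNER's CONSUMER NOTE in (GT) —, the `Q_k` regularity letters, `c₀(L^{n+1})^d = c₁`, `|η|^d∕c₀ ≤ ρ_w`, `3 ≤ L`,
`1 ≤ d`) stay hypotheses; the transposed row `A₀,k⁻¹D_U` is NOT here; nothing of [B9] Thm 3.1∕3.3∕3.11 is asserted, valued or discharged.  NOT NE9 (cell pub-balaban: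
NE9 NOT PRINTED ∕ NOT PROVED; «NE9 ⇐ the named binders»; row WALLED ON A MODEL (O-NE9-1; #5 UNRULED); spine PROVED 0∕9; rung (B)+1 on a finite T⁴ — NOT infinite volume,
NOT mass gap, NOT BetaPertH, NOT Clay; HONEST DEPENDENCY: continuum YM on T⁴ ⇐ BetaPertH ∧ nine spine estimates (0/9 proved); BetaPertH ⇐ (D1) ∧ (D4) ∧ CAP+tail;
G-an2-4 gates asym, D1 and NE2/3/4).  NEW file; nothing modified.  Net new unproved facts: 0.
-/


noncomputable section

set_option autoImplicit false

open scoped BigOperators InnerProductSpace ComplexConjugate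

namespace Literature.MathematicalPhysics.QuantumFieldTheory.Balaban1983to89.B9Eq326LocalPartTowerDivergenceRowDiagonalClosed

open B4Sect5Torus (TSite tdist)
open B4TorusKernel.MultiPeriod (circAbs)
open B9SectCLatticeCarrier (Bond DirPair bpos shift unshift)
open B9Eq311L2Pairing (WL2)
open B9Eq319QprimeTorus (fineP blockCoord)
open B7Prop1Explicit (U1 Wcx boxVec)
open B11Eq103H1Complex (BondL2K greenK covDerivL2K covDivL2K)
open B9Eq310DeltaPrime (plaqHolU reHol imHol)
open B9Eq310HessianOperator (adTransportW hessOp)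
open B9Eq315QTorus (perCfg cornerSite)
open B9Eq315QTower (towerP towerP_apply UlevOf)
open B9Eq316TowerFlatIsOneStep (towerP_eq_fineP_pow siteCast)
open B9Eq326OperatorTower (QkW)
open B9Eq342GreenPrimeSupBound (norm_adTransportW_eq norm_adTransportW_inv_eq)
open B9Ineq369CurvatureSmall (norm_reHol_sub_one_le norm_imHol_le)
open B9Eq342GradientRowComparisonMassUniform (window_of_tfree_window mul_weighted_row_le_uniform uniform_const_le_of_two_le)
open B9Eq326LocalPartTowerSupDecayDiagonalClosed (exists_sup_decay_localInvK_diagonal_closed)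
open B9Eq326LocalPartTowerDivergenceRow (norm_covDivL2K_localInvK_le_bigBlockLetter)

/-! ## §1 Real-arithmetic letters -/

section Letters

/-- **THE BRACKET OF (DVT) §2 AGAINST HEIGHT-FREE LETTERS** (linear pattern: the two direction sums `S`, `S′`, the order-zero term `P` and the
transporter term `q` are read off the goal; the letters enter as `T·S ≤ D_C`, `T·S′ ≤ D_C`, `P ≤ T·P₁`, `q ≤ T·Q₁`):
`M·(2TS + 2(P + q)·S′·C_u) ≤ M₁·(D_C·(2 + 2(P₁ + Q₁)C_u))`. [folklore] -/
private theorem bracket_le {M M₁ T S S' DC P P1 q Q1 Cu : ℝ}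
    (hM : M ≤ M₁) (hM0 : 0 ≤ M) (hT : 0 ≤ T) (hS : 0 ≤ S) (hS' : 0 ≤ S') (hTS : T * S ≤ DC) (hTS' : T * S' ≤ DC)
    (hP : P ≤ T * P1) (hq : q ≤ T * Q1) (hCu : 0 ≤ Cu) (hX1 : 0 ≤ 2 + 2 * (P1 + Q1) * Cu) (hP1 : 0 ≤ P1 + Q1) :
    M * (2 * T * S + 2 * (P + q) * S' * Cu) ≤ M₁ * (DC * (2 + 2 * (P1 + Q1) * Cu)) := by
  have hDC : 0 ≤ DC := (mul_nonneg hT hS).trans hTS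
  have h1 : 2 * T * S ≤ 2 * DC := by linarith
  have h2 : 2 * (P + q) * S' * Cu ≤ DC * (2 * (P1 + Q1) * Cu) := by
    have h3 : P + q ≤ T * (P1 + Q1) := by linarith
    have h4 : 2 * (P + q) * S' * Cu ≤ 2 * (T * (P1 + Q1)) * S' * Cu :=
      mul_le_mul_of_nonneg_right (mul_le_mul_of_nonneg_right (by linarith) hS') hCu
    have h5 : 2 * (T * (P1 + Q1)) * S' * Cu = (T * S') * (2 * (P1 + Q1) * Cu) := by ring
    rw [h5] at h4
    exact h4.trans (mul_le_mul_of_nonneg_right hTS' (by positivity))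
  have h6 : 2 * T * S + 2 * (P + q) * S' * Cu ≤ DC * (2 + 2 * (P1 + Q1) * Cu) := by linarith
  calc M * (2 * T * S + 2 * (P + q) * S' * Cu) ≤ M * (DC * (2 + 2 * (P1 + Q1) * Cu)) := mul_le_mul_of_nonneg_left h6 hM0
    _ ≤ M₁ * (DC * (2 + 2 * (P1 + Q1) * Cu)) := mul_le_mul_of_nonneg_right hM (mul_nonneg hDC hX1)

/-- **THE FINAL REORDERING**: `X ≤ B`, `0 ≤ F`, `0 ≤ E` ⟹ `X·F·E ≤ B·E·F`. [folklore] -/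
private theorem reorder_le {X B F E : ℝ} (hX : X ≤ B) (hF : 0 ≤ F) (hE : 0 ≤ E) : X * F * E ≤ B * E * F := by
  calc X * F * E ≤ B * F * E := mul_le_mul_of_nonneg_right (mul_le_mul_of_nonneg_right hX hF) hE
    _ = B * E * F := by ring

/-- **THE PENALTY-LETTER INEQUALITY**: `A·(P·(C∕s_c·(2·(N·(r·s_c))))) ≤ A·(P·(C₁·(2·(N·r))))` for `C ≤ C₁`, `s_c ≠ 0`. [folklore] -/
private theorem kQ_bound {A P C C₁ sc cnt r : ℝ} (hA : 0 ≤ A) (hP : 0 ≤ P) (hcr : 0 ≤ cnt * r) (hsc : sc ≠ 0) (hC : C ≤ C₁) :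
    A * (P * (C / sc * (2 * (cnt * (r * sc))))) ≤ A * (P * (C₁ * (2 * (cnt * r)))) := by
  rw [show A * (P * (C / sc * (2 * (cnt * (r * sc))))) = A * (P * (C * (2 * (cnt * r)))) * (sc / sc) by ring, div_self hsc, mul_one]
  exact mul_le_mul_of_nonneg_left (mul_le_mul_of_nonneg_left (mul_le_mul_of_nonneg_right hC (by linarith)) hP) hA

/-- **THE SMALLNESS WINDOW ON THE DIAGONAL**: `|T|·(αη) = α` (`Tη = 1`), `C_W·s ≤ C₁′`, `α ≤ α₁` ⟹ the window `hmK` of (DVT) from `2(2M_φM_φ′α₁)E·D·C₁′ ≤ S`.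
[folklore] -/
private theorem window_bound {T η Mφ Mφ' α α₁ E D CW C1' s S : ℝ} (hT : T * η = 1) (hT0 : 0 ≤ T) (hMφ : 0 ≤ Mφ) (hMφ' : 0 ≤ Mφ')
    (hα : 0 ≤ α) (hαle : α ≤ α₁) (hE : 0 ≤ E) (hD : 0 ≤ D) (hCW0 : 0 ≤ CW) (hCW : CW ≤ C1' / s) (hs : 0 < s)
    (hS : 2 * (2 * Mφ * Mφ' * α₁ * E * D * C1') ≤ S) :
    2 * ((|T| * (2 * Mφ * Mφ' * (α * η))) * E * D * (CW * s)) ≤ S := by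
  have e : |T| * (2 * Mφ * Mφ' * (α * η)) = 2 * Mφ * Mφ' * α * (T * η) := by rw [abs_of_nonneg hT0]; ring
  rw [e, hT, mul_one]
  have h1 : CW * s ≤ C1' := by have h := mul_le_mul_of_nonneg_right hCW hs.le; rwa [div_mul_cancel₀ _ hs.ne'] at h
  have hα₁ : 0 ≤ α₁ := hα.trans hαle
  have h2 : 2 * Mφ * Mφ' * α * E * D ≤ 2 * Mφ * Mφ' * α₁ * E * D :=
    mul_le_mul_of_nonneg_right (mul_le_mul_of_nonneg_right (mul_le_mul_of_nonneg_left hαle (by positivity)) hE) hD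
  have h3 : 2 * Mφ * Mφ' * α * E * D * (CW * s) ≤ 2 * Mφ * Mφ' * α₁ * E * D * C1' := mul_le_mul h2 h1 (by positivity) (by positivity)
  linarith

/-- **THE TRANSPORTER LETTER OVER THE FLOOR `β`**: `sinh θ ≥ θ = κ₀η` ⟹ `2M_φM_φ′(αη) ∕ (2 sinh θ∕(m_c − X)) ≤ M_φM_φ′α₁m_c∕κ₀` (`0 ≤ X < m_c`). [folklore] -/
private theorem q_bound {Mφ Mφ' α α₁ η mc X κ₀ : ℝ} (hMφ : 0 ≤ Mφ) (hMφ' : 0 ≤ Mφ') (hα : 0 ≤ α) (hαle : α ≤ α₁) (hη : 0 < η) (hκ₀ : 0 < κ₀)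
    (hsa : κ₀ * η ≤ Real.sinh (κ₀ * η)) (hX0 : 0 ≤ X) (hmX : 0 < mc - X) :
    2 * Mφ * Mφ' * (α * η) / (2 * Real.sinh (κ₀ * η) / (mc - X)) ≤ Mφ * Mφ' * α₁ * mc / κ₀ := by
  have hs : 0 < Real.sinh (κ₀ * η) := (mul_pos hκ₀ hη).trans_le hsa
  have hα₁ : 0 ≤ α₁ := hα.trans hαle
  have hmc : 0 ≤ mc := by linarith
  rw [div_div_eq_mul_div, div_le_div_iff₀ (by positivity) hκ₀]
  have h1 : 2 * Mφ * Mφ' * (α * η) * (mc - X) ≤ 2 * Mφ * Mφ' * (α₁ * η) * mc :=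
    mul_le_mul (mul_le_mul_of_nonneg_left (mul_le_mul_of_nonneg_right hαle hη.le) (by positivity)) (by linarith) hmX.le (by positivity)
  calc 2 * Mφ * Mφ' * (α * η) * (mc - X) * κ₀ ≤ 2 * Mφ * Mφ' * (α₁ * η) * mc * κ₀ := mul_le_mul_of_nonneg_right h1 hκ₀.le
    _ = Mφ * Mφ' * α₁ * mc * (2 * (κ₀ * η)) := by ring
    _ ≤ Mφ * Mφ' * α₁ * mc * (2 * Real.sinh (κ₀ * η)) := mul_le_mul_of_nonneg_left (by linarith) (by positivity)
end Letters

/-! ## §2 The divergence row of the tower local part, fully closed on the diagonal -/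

section Closed

variable {d : ℕ} (hd : 1 ≤ d) (L : ℕ) [NeZero L] (hL : 1 ≤ L) (hL3 : 3 ≤ L)
  {𝔸 : Type*} [NormedRing 𝔸] [NormedAlgebra ℂ 𝔸] [CompleteSpace 𝔸] [NormOneClass 𝔸] [StarRing 𝔸] [NormedStarGroup 𝔸] [StarModule ℂ 𝔸]
  {W : Type*} [NormedAddCommGroup W] [InnerProductSpace ℂ W] [FiniteDimensional ℂ W] (φ : W ≃ₗ[ℂ] 𝔸)
  {Mφ Mφ' : ℝ} (hMφ : 0 ≤ Mφ) (hMφ' : 0 ≤ Mφ') (hφ : ∀ w, ‖φ w‖ ≤ Mφ * ‖w‖) (hφ' : ∀ X, ‖φ.symm X‖ ≤ Mφ' * ‖X‖) (hstar : ∀ X : 𝔸, ‖star X‖ ≤ ‖X‖)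
  {a : ℝ} (ha : 0 < a) {a' : ℝ} (ha' : 0 < a') {ϱ : ℝ} (hϱ0 : 0 ≤ ϱ) (hϱ1 : ϱ < 1)
  (τ : 𝔸 →ₗ[ℂ] ℂ) {Cτ : ℝ} (hτ : ∀ X, ‖τ X‖ ≤ Cτ * ‖X‖) (hCτ : 0 ≤ Cτ) {Mτ : ℝ} (hτm : ∀ X Y : 𝔸, ‖τ (X * Y)‖ ≤ Mτ * ‖X‖ * ‖Y‖) (hMτ : 0 ≤ Mτ)
  {ρw : ℝ} (hρw : 0 ≤ ρw)
  (hτ₁ : ∀ X : 𝔸, τ (star X) = conj (τ X)) (hτ₂ : ∀ X Y : 𝔸, τ (X * Y) = τ (Y * X)) (hφτ : ∀ X Y : 𝔸, ⟪φ.symm X, φ.symm Y⟫_ℂ = τ (star X * Y))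
  (AQ : ℝ)

set_option maxHeartbeats 400000 in -- ≈ 55 binders + the displayed closed form of (DVT) §2 read off the goal: the bookkeeping exceeds the default budget
include hd hL hL3 hMφ hMφ' hφ hφ' hstar ha ha' hϱ0 hϱ1 hτ hCτ hτm hMτ hρw hτ₁ hτ₂ hφτ in
/-- **THE DIVERGENCE ROW OF THE TOWER LOCAL PART, FULLY CLOSED ON THE DIAGONAL — `∃ α₁ B δ` BEFORE `∀ n η c₀ c₁ m U`.**  For every height `n`, spacing `η`
(`ηL^{n+1} = 1`), weights on the diagonal with `|η|^d∕c₀ ≤ ρ_w`, lattice `m` (`1 ≤ m_i`), background `U` of the MODEL letters in the window `α ≤ α₁` — INCLUDING the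
bond-gradient datum `‖U(x,μ) − U(x−e_μ,μ)‖ ≤ αη²` (the OWNER's `a_U`; beta-an4's agreed `hUgrad`) — and the loop window `Σ_{j<n+1}α_j ≤ A_Q`, every positivity witness
`hpos₀` of `A₀ = Δ(U) + D_UD*_U + Q_k(U)†(a•Q_k(U))`, every big-block bond family `P`, every source `f` supported over the bonds of the unit block `v` with `‖f(b)‖ ≤ F`,
every fine site `y`: `‖(D*_U(A₀⁻¹f))(y)‖ ≤ B·e^{−δ·d_m(Πy, v)}·F` — (DVT) §2 `norm_covDivL2K_localInvK_le_bigBlockLetter`, value row := (ECL), the diagonal choices of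
the module header. [cite: Balaban1985BackgroundPropagators, Thm 3.1 (3.42) p.397, (3.26) p.395, (3.8) p.392, (3.35) p.396, (3.49) p.399; Balaban1985Variational, (134)–(136) p.298] -/
theorem exists_divergence_row_localInvK_diagonal_closed :
    ∃ α₁ B δ : ℝ, 0 < α₁ ∧ 0 ≤ B ∧ 0 < δ ∧
      ∀ (n : ℕ) (η : ℝ) (_hηL : η * (L : ℝ) ^ (n + 1) = 1) (c₀ c₁ : ℝ) [Fact (0 < c₀)] [Fact (0 < c₁)]
        (_hw : c₀ * ((L : ℝ) ^ (n + 1)) ^ d = c₁) (_hρ : |η| ^ d / c₀ ≤ ρw) (m : Fin d → ℕ) [∀ i, NeZero (m i)] (_hm : ∀ i, 1 ≤ m i)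
        (U : Bond d (towerP L m (n + 1)) → 𝔸ˣ) (αU : ℕ → ℝ) (_hα0 : ∀ j, 0 ≤ αU j) (hα1 : ∀ j, αU j ≤ 1 / 64)
        (hU1 : ∀ (j : ℕ) (x : B7Prop1Explicit.Site d) (k : Fin d), perCfg (towerP L m (j + 1)) (UlevOf L m (n + 1) U j) x k ∈ U1 𝔸)
        (hreg : ∀ (j : ℕ) (y : TSite d (towerP L m j)) (k : Fin d) (ρ' : Fin d → Fin L),
          ‖((Wcx L (perCfg (towerP L m (j + 1)) (UlevOf L m (n + 1) U j)) (cornerSite L y) k (boxVec L ρ') : 𝔸ˣ) : 𝔸) - 1‖ ≤ αU j)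
        (εU : ℕ → ℝ) (_hεU : ∀ j, 0 ≤ εU j) (_hUε : ∀ (j : ℕ) (b : Bond d (towerP L m (j + 1))), ‖(UlevOf L m (n + 1) U j b : 𝔸) - 1‖ ≤ εU j)
        (_hLb : ∀ (j : ℕ) (b : Bond d (towerP L m (j + 1))), UlevOf L m (n + 1) U j b ∈ U1 𝔸)
        (α : ℝ) (_hα : 0 ≤ α) (_hαle : α ≤ α₁) (_hUst : ∀ b, star (U b : 𝔸) = (((U b)⁻¹ : 𝔸ˣ) : 𝔸)) (_hUb : ∀ b, U b ∈ U1 𝔸)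
        (_hUη : ∀ b, ‖(U b : 𝔸) - 1‖ ≤ α * η)
        (_hpl : ∀ p : B9SectCLatticeCarrier.Plaq d (towerP L m (n + 1)), ‖(plaqHolU U p : 𝔸) - 1‖ ≤ α * η ^ 2)
        (_hUgrad : ∀ (x : TSite d (towerP L m (n + 1))) (μ : Fin d), ‖(U (x, μ) : 𝔸) - (U (unshift μ x, μ) : 𝔸)‖ ≤ α * η ^ 2)
        (_hεg : ∀ j < n + 1, εU j ≤ α * ϱ ^ j) (_hAQ : ∑ j ∈ Finset.range (n + 1), αU j ≤ AQ)
        (A₀ : BondL2K ℂ d (towerP L m (n + 1)) c₀ W →ₗ[ℂ] BondL2K ℂ d (towerP L m (n + 1)) c₀ W)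
        (_hA₀ : A₀ = hessOp φ η U τ + covDerivL2K ℂ c₀ ((η : ℂ))⁻¹ (adTransportW φ U) ∘ₗ covDivL2K ℂ c₀ ((η : ℂ))⁻¹ (adTransportW φ fun b => (U b)⁻¹) +
          LinearMap.adjoint (QkW L m n φ U hL αU hα1 hU1 hreg (c₀ := c₀) (c₁ := c₁)) ∘ₗ ((a : ℂ) • QkW L m n φ U hL αU hα1 hU1 hreg (c₀ := c₀) (c₁ := c₁)))
        (hpos₀ : ∀ x : BondL2K ℂ d (towerP L m (n + 1)) c₀ W, x ≠ 0 → 0 < RCLike.re ⟪x, A₀ x⟫_ℂ)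
        (PB : TSite d m → BondL2K ℂ d (towerP L m (n + 1)) c₀ W →L[ℂ] BondL2K ℂ d (towerP L m (n + 1)) c₀ W)
        (_hPB : ∀ (y : TSite d m) (f : BondL2K ℂ d (towerP L m (n + 1)) c₀ W) (b : Bond d (towerP L m (n + 1))),
          WL2.equiv ℂ (fun _ : Bond d (towerP L m (n + 1)) => c₀) W (PB y f) b =
            if blockCoord (L ^ (n + 1)) m (siteCast (towerP_eq_fineP_pow L m (n + 1)) (bpos b)) = y then
              WL2.equiv ℂ (fun _ : Bond d (towerP L m (n + 1)) => c₀) W f b else 0)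
        (v : TSite d m) (f : BondL2K ℂ d (towerP L m (n + 1)) c₀ W)
        (_hfv : ∀ b, blockCoord (L ^ (n + 1)) m (siteCast (towerP_eq_fineP_pow L m (n + 1)) b.1) ≠ v →
          WL2.equiv ℂ (fun _ : Bond d (towerP L m (n + 1)) => c₀) W f b = 0)
        (F : ℝ) (_hF0 : 0 ≤ F) (_hfF : ∀ b, ‖WL2.equiv ℂ (fun _ : Bond d (towerP L m (n + 1)) => c₀) W f b‖ ≤ F)
        (y : TSite d (towerP L m (n + 1))),
        ‖WL2.equiv ℂ (fun _ : TSite d (towerP L m (n + 1)) => c₀) W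
            (covDivL2K ℂ c₀ ((η : ℂ))⁻¹ (adTransportW φ fun bb => (U bb)⁻¹) (greenK A₀ hpos₀ f)) y‖ ≤
          B * Real.exp (-(δ * tdist m (blockCoord (L ^ (n + 1)) m (siteCast (towerP_eq_fineP_pow L m (n + 1)) y)) v)) * F := by
  classical
  obtain ⟨hd1, hd0⟩ : (1 : ℝ) ≤ d ∧ (0 : ℝ) ≤ (d : ℝ) - 1 := ⟨by exact_mod_cast hd, by have h : (1 : ℝ) ≤ d := (by exact_mod_cast hd); linarith⟩
  obtain ⟨α₁, BE, δE, hα₁, hBE, hδE, HE⟩ := exists_sup_decay_localInvK_diagonal_closed hd L hL hL3 φ hMφ hMφ' hφ hφ' hstar ha ha' hϱ0 hϱ1 τ hτ hCτ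
    hτm hMτ hρw hτ₁ hτ₂ hφτ AQ
  set κ₀ : ℝ := δE with hκ₀
  have hκ₀0 : 0 < κ₀ := hδE
  set b1 : ℝ := 2 * Mφ * Mφ' * α₁ with hb1
  have hb10 : 0 ≤ b1 := by positivity
  set Ssm : ℝ := 2 * (b1 * (Real.exp κ₀ + 1) * (d : ℝ) * ((1 + 2 / 1) * Real.sqrt 2 + 4 * Real.sinh κ₀)) with hSsm
  have hsinh0 : 0 ≤ Real.sinh κ₀ := Real.sinh_nonneg_iff.mpr hκ₀0.le
  have hSsm0 : 0 ≤ Ssm := by positivity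
  set mc : ℝ := max 2 (max (4 * (d : ℝ) * (Real.cosh κ₀ - 1)) (Ssm ^ 2)) with hmc
  have hmc2 : 2 ≤ mc := le_max_left _ _
  have hmc0 : 0 < mc := by linarith only [hmc2]
  have hwin4 : 4 * (d : ℝ) * (Real.cosh κ₀ - 1) ≤ mc := (le_max_left _ _).trans (le_max_right _ _)
  have hSmc : Ssm ≤ Real.sqrt mc := by
    have h : Ssm ^ 2 ≤ mc := (le_max_right _ _).trans (le_max_right _ _)
    calc Ssm = Real.sqrt (Ssm ^ 2) := (Real.sqrt_sq hSsm0).symm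
      _ ≤ Real.sqrt mc := Real.sqrt_le_sqrt h
  set C₁ : ℝ := ((1 + 2 / 1) * Real.sqrt 2 + 4 * Real.sinh κ₀) / Real.sqrt mc with hC₁
  have hC₁0 : 0 ≤ C₁ := by positivity
  set Ex : ℝ := Real.exp (2 * κ₀ * (d : ℝ)) with hEx
  set Pw : ℝ := 768 * Fintype.card (DirPair d) * Mτ * Mφ ^ 2 * ρw with hPw
  have hPw0 : 0 ≤ Pw := by positivity
  set EQ : ℝ := Real.exp (100 * d * (d + 1) * (L : ℝ) ^ d * AQ) with hEQ
  set CQ1 : ℝ := Mφ' * Mφ * Real.exp (Real.sqrt ((L : ℝ) ^ d) * (Real.sqrt (2 * d) * (102 * (d + 1) ^ 2 * L)) * (α₁ / (1 - ϱ))) with hCQ1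
  set KQ1 : ℝ := |a| * (Mφ' * Mφ * EQ * ((2 * d : ℕ) : ℝ) * (CQ1 * (2 * ((Fintype.card (Option (Fin d × Bool)) : ℝ) * Real.sqrt d)))) with hKQ1
  have hKQ10 : 0 ≤ KQ1 := by positivity
  set cP1 : ℝ := (Pw * α₁ + KQ1 + 4 * ((d : ℝ) - 1) * (Mφ * Mφ') * α₁) * Ex with hcP1
  have hcP10 : 0 ≤ cP1 := by positivity
  set Z1 : ℝ := 2 * Mφ * Mφ' * α₁ + (2 * Mφ * Mφ' * α₁) * (2 * Mφ * Mφ' * α₁) with hZ1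
  have hZ10 : 0 ≤ Z1 := by positivity
  set Q1 : ℝ := Mφ * Mφ' * α₁ * mc / κ₀ with hQ1
  have hQ10 : 0 ≤ Q1 := by positivity
  have hP10 : 0 ≤ ((cP1 + mc) + (d : ℝ) * Z1) + Q1 := by positivity
  have hX1 : 0 ≤ 2 + 2 * (((cP1 + mc) + (d : ℝ) * Z1) + Q1) * BE := by positivity
  set Bf : ℝ := 2 * Real.exp κ₀ * (((d : ℝ) * C₁) * (2 + 2 * (((cP1 + mc) + (d : ℝ) * Z1) + Q1) * BE)) with hBf
  have hBf0 : 0 ≤ Bf := by positivity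
  refine ⟨α₁, Bf, δE, hα₁, hBf0, hδE, ?_⟩
  intro n η hηL c₀ c₁ _ _ hw hρ m _ hm U αU hαU0 hα1 hU1 hreg εU hεU hUε hLb α hα hαle hUst hUb hUη hpl hUgrad hεg hAQ A₀ hA₀ hpos₀ PB hPB v f hfv F hF0
    hfF y
  obtain ⟨hc₀, hc₁⟩ : (0 : ℝ) < c₀ ∧ (0 : ℝ) < c₁ := ⟨Fact.out, Fact.out⟩
  have hL0 : (0 : ℝ) < L := by exact_mod_cast (lt_of_lt_of_le (by norm_num) hL3 : 0 < L)
  have htpos : 0 < (L : ℝ) ^ (n + 1) := pow_pos hL0 _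
  have ht1' : (1 : ℝ) ≤ (L : ℝ) ^ (n + 1) := one_le_pow₀ (by exact_mod_cast hL)
  have hη : 0 < η := (mul_pos_iff_of_pos_right htpos).mp (hηL ▸ one_pos)
  have hηt : η⁻¹ = (L : ℝ) ^ (n + 1) := by rw [eq_inv_of_mul_eq_one_left hηL, inv_inv]
  have ht1 : (1 : ℝ) ≤ η⁻¹ := by rw [hηt]; exact ht1'
  have ht0 : (0 : ℝ) < η⁻¹ := by linarith only [ht1]
  have hη1 : η ≤ 1 := by have h := mul_le_mul_of_nonneg_left ht1' hη.le; rwa [mul_one, hηL] at h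
  have hηη : η⁻¹ * η = 1 := inv_mul_cancel₀ hη.ne'
  have habs : |η⁻¹| = η⁻¹ := abs_of_pos ht0
  have hnorm : ‖((η⁻¹ : ℝ) : ℂ)‖ = η⁻¹ := by rw [Complex.norm_real, Real.norm_eq_abs, habs]
  have hnmc : ‖((mc : ℝ) : ℂ)‖ = mc := by rw [Complex.norm_real, Real.norm_eq_abs, abs_of_pos hmc0]
  have hθ : 0 ≤ κ₀ * η := mul_nonneg hκ₀0.le hη.le
  have hθpos : 0 < κ₀ * η := mul_pos hκ₀0 hη
  have hθL : κ₀ * η * (L : ℝ) ^ (n + 1) = κ₀ := by rw [mul_assoc, hηL, mul_one]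
  have hκθ : δE ≤ κ₀ * η * (L : ℝ) ^ (n + 1) := by rw [hθL]
  have hθκ : κ₀ * η ≤ κ₀ := mul_le_of_le_one_right hκ₀0.le hη1
  have hdiv : κ₀ / η⁻¹ = κ₀ * η := div_inv_eq_mul κ₀ η
  have hlam4 := window_of_tfree_window ht1 hκ₀0.le d hwin4
  rw [hdiv] at hlam4
  have hch : 0 ≤ Real.cosh (κ₀ * η) - 1 := by linarith only [Real.one_le_cosh (κ₀ * η)]
  have hX1' : 0 ≤ η⁻¹ ^ 2 * (Real.cosh (κ₀ * η) - 1) := by positivity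
  have hX0' : 0 ≤ (d : ℝ) * (η⁻¹ ^ 2 * (Real.cosh (κ₀ * η) - 1)) := by positivity
  have eX : 2 * (d : ℝ) * η⁻¹ ^ 2 * (Real.cosh (κ₀ * η) - 1) = 2 * ((d : ℝ) * (η⁻¹ ^ 2 * (Real.cosh (κ₀ * η) - 1))) := by ring
  have eX4 : 4 * (d : ℝ) * (η⁻¹ ^ 2 * (Real.cosh (κ₀ * η) - 1)) = 4 * ((d : ℝ) * (η⁻¹ ^ 2 * (Real.cosh (κ₀ * η) - 1))) := by ring
  rw [eX4] at hlam4
  have hlamN : 2 * ((d : ℝ) * (η⁻¹ ^ 2 * (Real.cosh (κ₀ * η) - 1))) < mc := by linarith only [hlam4, hX0', hmc0]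
  have hlam : 2 * (d : ℝ) * η⁻¹ ^ 2 * (Real.cosh (κ₀ * η) - 1) < mc := by rw [eX]; exact hlamN
  have hm'' : 0 < mc - 2 * (d : ℝ) * η⁻¹ ^ 2 * (Real.cosh (κ₀ * η) - 1) := by rw [eX]; linarith only [hlamN]
  have hn : ∀ ν, 2 ≤ towerP L m (n + 1) ν := fun ν => by
    rw [towerP_apply]
    exact ((le_trans (by norm_num) hL3).trans (Nat.le_self_pow (Nat.succ_ne_zero n) L)).trans (Nat.le_mul_of_pos_right _ (hm ν))
  have hLn : ∀ ν : Fin d, (1 : ℝ) * η⁻¹ ≤ (towerP L m (n + 1) ν : ℝ) := fun ν => by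
    rw [one_mul, hηt, towerP_apply, Nat.cast_mul, Nat.cast_pow]; exact le_mul_of_one_le_right htpos.le (by exact_mod_cast hm ν)
  have hsinh : 0 < Real.sinh (κ₀ * η) := Real.sinh_pos_iff.mpr hθpos
  have hβ : 0 < 2 * Real.sinh (κ₀ * η) / (mc - 2 * (d : ℝ) * η⁻¹ ^ 2 * (Real.cosh (κ₀ * η) - 1)) := by positivity
  have hCW : 0 ≤ (1 + 2 / (1 * Real.sqrt (mc / 2))) / Real.sqrt (mc / 2) + 4 * Real.sinh κ₀ / mc := by positivity
  have htB : ∀ ν, ‖((η⁻¹ : ℝ) : ℂ)‖ * (fun ν : Fin d => (1 + Real.exp (-(κ₀ * η))) *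
        ((1 + 2 * η⁻¹ / (towerP L m (n + 1) ν * Real.sqrt (mc - 2 * ((d : ℝ) - 1) * η⁻¹ ^ 2 * (Real.cosh (κ₀ * η) - 1)))) /
          Real.sqrt ((mc - 2 * ((d : ℝ) - 1) * η⁻¹ ^ 2 * (Real.cosh (κ₀ * η) - 1)) ^ 2 +
            4 * (mc - 2 * ((d : ℝ) - 1) * η⁻¹ ^ 2 * (Real.cosh (κ₀ * η) - 1)) * η⁻¹ ^ 2)) +
        2 * Real.sinh (κ₀ * η) / (mc - 2 * (d : ℝ) * η⁻¹ ^ 2 * (Real.cosh (κ₀ * η) - 1))) ν ≤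
      (1 + 2 / (1 * Real.sqrt (mc / 2))) / Real.sqrt (mc / 2) + 4 * Real.sinh κ₀ / mc := fun ν => by
    have h := mul_weighted_row_le_uniform η⁻¹ ht1 (m := mc) (κ := κ₀) (n := (towerP L m (n + 1) ν : ℝ)) (L := 1) hmc0 hκ₀0.le one_pos (hLn ν) d hwin4
    rw [hdiv] at h
    rw [hnorm]
    exact h
  have hsm : 0 < Real.sqrt mc := Real.sqrt_pos.2 hmc0
  have hCle := uniform_const_le_of_two_le (κ := κ₀) (L := (1 : ℝ)) hmc2 hκ₀0.le one_pos
  have hCK : (1 + 2 / (1 * Real.sqrt (mc / 2))) / Real.sqrt (mc / 2) + 4 * Real.sinh κ₀ / mc ≤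
      ((1 + 2 / (1 * Real.sqrt (mc / 2))) / Real.sqrt (mc / 2) + 4 * Real.sinh κ₀ / mc) * Real.sqrt mc / Real.sqrt mc :=
    (mul_div_cancel_right₀ _ hsm.ne').symm.le
  have hbα : 2 * Mφ * Mφ' * α ≤ b1 := by rw [hb1]; exact mul_le_mul_of_nonneg_left hαle (by positivity)
  have hmK := window_bound (E := Real.exp κ₀ + 1) (D := (d : ℝ)) hηη ht0.le hMφ hMφ' hα hαle (by positivity) (Nat.cast_nonneg d)
    hCW hCle hsm hSmc
  have hudec : ∀ b : Bond d (towerP L m (n + 1)), ‖WL2.equiv ℂ (fun _ : Bond d (towerP L m (n + 1)) => c₀) W (greenK A₀ hpos₀ f) b‖ ≤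
      BE * F * Real.exp (-(δE * tdist m (blockCoord (L ^ (n + 1)) m (siteCast (towerP_eq_fineP_pow L m (n + 1)) b.1)) v)) := fun b =>
    (HE n η hηL c₀ c₁ hw hρ m hm U αU hαU0 hα1 hU1 hreg εU hεU hUε hLb α hα hαle hUst hUb hUη hpl hεg hAQ A₀ hA₀ hpos₀ PB hPB v f hfv F hF0 hfF b).trans
      (le_of_eq (by ring))
  have hU' : ∀ b, ‖(U b : 𝔸)‖ ≤ 1 ∧ ‖(((U b)⁻¹ : 𝔸ˣ) : 𝔸)‖ ≤ 1 := fun b => B7Prop1Explicit.mem_U1.mp (hUb b)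
  have hRe : ∀ p : B9SectCLatticeCarrier.Plaq d (towerP L m (n + 1)), ‖reHol U p - 1‖ ≤ α * η ^ 2 :=
    fun p => norm_reHol_sub_one_le (hU := hU') (hpl p)
  have hIm : ∀ p : B9SectCLatticeCarrier.Plaq d (towerP L m (n + 1)), ‖imHol U p‖ ≤ α * η ^ 2 := fun p => norm_imHol_le (hU := hU') (hpl p)
  have hδ : 0 ≤ α * η ^ 2 := by positivity
  have hεt : 0 ≤ α * η := by positivity
  have hR : ∀ (b : Bond d (towerP L m (n + 1))) (w : W), ‖adTransportW φ U b w‖ ≤ ‖w‖ :=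
    fun b w => le_of_eq (norm_adTransportW_eq φ U τ hτ₂ hUst hφτ b w)
  have hS : ∀ (b : Bond d (towerP L m (n + 1))) (w : W), ‖adTransportW φ (fun b => (U b)⁻¹) b w‖ ≤ ‖w‖ :=
    fun b w => le_of_eq (norm_adTransportW_inv_eq φ U τ hτ₂ hUst hφτ b w)
  have hmain := norm_covDivL2K_localInvK_le_bigBlockLetter L m n φ U hL αU hαU0 hα1 hU1 hreg hMφ hφ hMφ' hφ' hstar εU hεU hUε hϱ0 hϱ1 hα hεg τ hτm hMτ
    hη hUb hδ hRe hIm hεt hδ hUη hUgrad hPB mc (κ₀ * η) hmc0 hm hd hn hR hS a A₀ hA₀ hpos₀ hw hAQ hθ hlam v f hF0 hBE hδE.le hκθ hfv hfF hudec hβ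
    (fun ν => le_add_of_nonneg_left (by positivity)) hθκ hCW htB hCK hmK y
  have hexp1 : κ₀ * η * ((L : ℝ) ^ (n + 1) - 1) ≤ κ₀ := by
    have e : κ₀ * η * ((L : ℝ) ^ (n + 1) - 1) = κ₀ * η * (L : ℝ) ^ (n + 1) - κ₀ * η := by ring
    rw [e, hθL]; linarith only [hθ]
  have hexp : 2 * Real.exp (κ₀ * η * ((L : ℝ) ^ (n + 1) - 1)) ≤ 2 * Real.exp κ₀ := by linarith only [Real.exp_le_exp.mpr hexp1]
  have htC : ∀ ν : Fin d, _ := fun ν : Fin d => by have h := (htB ν).trans hCle; rw [hnorm] at h; exact h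
  have hWle : η⁻¹ ^ 2 * (2 * Mφ * Mφ' * (α * η ^ 2) + 2 * Mφ * Mφ' * (α * η) * (2 * Mφ * Mφ' * (α * η))) ≤ Z1 := by
    have e : η⁻¹ ^ 2 * (2 * Mφ * Mφ' * (α * η ^ 2) + 2 * Mφ * Mφ' * (α * η) * (2 * Mφ * Mφ' * (α * η))) =
        (2 * Mφ * Mφ' * α + (2 * Mφ * Mφ' * α) * (2 * Mφ * Mφ' * α)) * (η⁻¹ * η) ^ 2 := by ring
    rw [e, hηη, one_pow, mul_one, hZ1]
    have h0 : 0 ≤ 2 * Mφ * Mφ' * α := by positivity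
    exact add_le_add hbα (mul_le_mul hbα hbα h0 hb10)
  have hX2 : 0 ≤ 2 * (d : ℝ) * η⁻¹ ^ 2 * (Real.cosh (κ₀ * η) - 1) := by positivity
  have hQle : 2 * Mφ * Mφ' * (α * η) / (2 * Real.sinh (κ₀ * η) / (mc - 2 * (d : ℝ) * η⁻¹ ^ 2 * (Real.cosh (κ₀ * η) - 1))) ≤ Q1 :=
    q_bound hMφ hMφ' hα hαle hη hκ₀0 (Real.self_le_sinh_iff.mpr hθpos.le) hX2 hm''
  have hn1 : ‖((η : ℂ)) ^ d‖ = |η| ^ d := by rw [norm_pow, Complex.norm_real, Real.norm_eq_abs]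
  have hn2 : ‖((η : ℂ))⁻¹‖ ^ 2 * (α * η ^ 2) = α := by
    rw [norm_inv, Complex.norm_real, Real.norm_eq_abs, abs_of_pos hη]
    calc η⁻¹ ^ 2 * (α * η ^ 2) = α * (η⁻¹ * η) ^ 2 := by ring
      _ = α := by rw [hηη, one_pow, mul_one]
  have hpK : 768 * Fintype.card (DirPair d) * Mτ * Mφ ^ 2 * (‖((η : ℂ)) ^ d‖ / c₀) * ‖((η : ℂ))⁻¹‖ ^ 2 * (α * η ^ 2) ≤ Pw * α₁ := by
    have h0 : 0 ≤ 768 * (Fintype.card (DirPair d) : ℝ) * Mτ * Mφ ^ 2 * α := by positivity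
    calc 768 * Fintype.card (DirPair d) * Mτ * Mφ ^ 2 * (‖((η : ℂ)) ^ d‖ / c₀) * ‖((η : ℂ))⁻¹‖ ^ 2 * (α * η ^ 2)
          = 768 * Fintype.card (DirPair d) * Mτ * Mφ ^ 2 * α * (|η| ^ d / c₀) := by
            rw [mul_assoc (768 * Fintype.card (DirPair d) * Mτ * Mφ ^ 2 * (‖((η : ℂ)) ^ d‖ / c₀)), hn2, hn1]; ring
      _ ≤ 768 * Fintype.card (DirPair d) * Mτ * Mφ ^ 2 * α * ρw := mul_le_mul_of_nonneg_left hρ h0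
      _ = Pw * α := by rw [hPw]; ring
      _ ≤ Pw * α₁ := mul_le_mul_of_nonneg_left hαle hPw0
  have hwz' : ‖((η : ℂ))⁻¹ * ((η : ℂ))⁻¹‖ * ((d - 1 : ℝ) * (2 * Mφ * Mφ' * (2 * (α * η ^ 2)))) ≤ 4 * ((d : ℝ) - 1) * (Mφ * Mφ') * α₁ := by
    rw [norm_mul, norm_inv, Complex.norm_real, Real.norm_eq_abs, abs_of_pos hη]
    calc η⁻¹ * η⁻¹ * ((d - 1 : ℝ) * (2 * Mφ * Mφ' * (2 * (α * η ^ 2)))) = 4 * (d - 1 : ℝ) * (Mφ * Mφ') * α * (η⁻¹ * η) ^ 2 := by ring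
      _ = 4 * (d - 1 : ℝ) * (Mφ * Mφ') * α := by rw [hηη, one_pow, mul_one]
      _ ≤ 4 * ((d : ℝ) - 1) * (Mφ * Mφ') * α₁ := mul_le_mul_of_nonneg_left hαle (by positivity)
  have hE2 : Real.exp (κ₀ * η) ^ 2 ≤ Ex := by
    rw [← Real.exp_nat_mul, hEx]
    refine Real.exp_le_exp.mpr ?_
    calc ((2 : ℕ) : ℝ) * (κ₀ * η) ≤ 2 * κ₀ := by push_cast; linarith only [hθκ]
      _ = 2 * κ₀ * 1 := by ring
      _ ≤ 2 * κ₀ * (d : ℝ) := mul_le_mul_of_nonneg_left hd1 (by positivity)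
  have hE3 : Real.exp (κ₀ * η * (d : ℝ) * ((L : ℝ) ^ (n + 1) * 1 + ((L : ℝ) ^ (n + 1) - 1))) ≤ Ex := by
    rw [hEx]
    refine Real.exp_le_exp.mpr ?_
    have e2 : κ₀ * η * (d : ℝ) * ((L : ℝ) ^ (n + 1) * 1 + ((L : ℝ) ^ (n + 1) - 1)) =
        (d : ℝ) * (κ₀ * η * (L : ℝ) ^ (n + 1) + κ₀ * η * ((L : ℝ) ^ (n + 1) - 1)) := by ring
    rw [e2, hθL]
    calc (d : ℝ) * (κ₀ + κ₀ * η * ((L : ℝ) ^ (n + 1) - 1)) ≤ (d : ℝ) * (κ₀ + κ₀) :=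
          mul_le_mul_of_nonneg_left (by linarith only [hexp1]) (Nat.cast_nonneg d)
      _ = 2 * κ₀ * (d : ℝ) := by ring
  have hsq : Real.sqrt (c₀ * (d * ((L : ℝ) ^ (n + 1)) ^ d)) = Real.sqrt d * Real.sqrt c₁ := by
    rw [← hw, show c₀ * (d * ((L : ℝ) ^ (n + 1)) ^ d) = d * (c₀ * ((L : ℝ) ^ (n + 1)) ^ d) by ring, Real.sqrt_mul' _ (by positivity)]
  have hCQ : Mφ' * Mφ * Real.exp (Real.sqrt ((L : ℝ) ^ d) * (Real.sqrt (2 * d) * (102 * (d + 1) ^ 2 * L)) * (α / (1 - ϱ))) ≤ CQ1 := by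
    rw [hCQ1]
    refine mul_le_mul_of_nonneg_left (Real.exp_le_exp.mpr (mul_le_mul_of_nonneg_left ?_ (by positivity))) (mul_nonneg hMφ' hMφ)
    exact div_le_div_of_nonneg_right hαle (by linarith only [hϱ1])
  have hKQ : |a| * (Mφ' * Mφ * Real.exp (100 * d * (d + 1) * (L : ℝ) ^ d * AQ) * ((2 * d : ℕ) : ℝ) *
      ((Mφ' * Mφ * Real.exp (Real.sqrt ((L : ℝ) ^ d) * (Real.sqrt (2 * d) * (102 * (d + 1) ^ 2 * L)) * (α / (1 - ϱ)))) / Real.sqrt c₁ *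
        (2 * ((Fintype.card (Option (Fin d × Bool)) : ℝ) * Real.sqrt (c₀ * (d * ((L : ℝ) ^ (n + 1)) ^ d)))))) ≤ KQ1 := by
    rw [hsq, hKQ1, hEQ]
    exact kQ_bound (abs_nonneg a) (by positivity) (by positivity) (Real.sqrt_pos.mpr hc₁).ne' hCQ
  have hcP : 768 * Fintype.card (DirPair d) * Mτ * Mφ ^ 2 * (‖((η : ℂ)) ^ d‖ / c₀) * ‖((η : ℂ))⁻¹‖ ^ 2 * (α * η ^ 2) * Real.exp (κ₀ * η) ^ 2 +
      |a| * (Mφ' * Mφ * Real.exp (100 * d * (d + 1) * (L : ℝ) ^ d * AQ) * ((2 * d : ℕ) : ℝ) *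
        ((Mφ' * Mφ * Real.exp (Real.sqrt ((L : ℝ) ^ d) * (Real.sqrt (2 * d) * (102 * (d + 1) ^ 2 * L)) * (α / (1 - ϱ)))) / Real.sqrt c₁ *
          (2 * ((Fintype.card (Option (Fin d × Bool)) : ℝ) * Real.sqrt (c₀ * (d * ((L : ℝ) ^ (n + 1)) ^ d)))))) *
        Real.exp (κ₀ * η * (d : ℝ) * ((L : ℝ) ^ (n + 1) * 1 + ((L : ℝ) ^ (n + 1) - 1))) +
      ‖((η : ℂ))⁻¹ * ((η : ℂ))⁻¹‖ * ((d - 1 : ℝ) * (2 * Mφ * Mφ' * (2 * (α * η ^ 2))) * Real.exp (κ₀ * η) ^ 2) ≤ cP1 := by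
    have e3 : ‖((η : ℂ))⁻¹ * ((η : ℂ))⁻¹‖ * ((d - 1 : ℝ) * (2 * Mφ * Mφ' * (2 * (α * η ^ 2))) * Real.exp (κ₀ * η) ^ 2) =
        ‖((η : ℂ))⁻¹ * ((η : ℂ))⁻¹‖ * ((d - 1 : ℝ) * (2 * Mφ * Mφ' * (2 * (α * η ^ 2)))) * Real.exp (κ₀ * η) ^ 2 := by ring
    rw [e3, hcP1, add_mul, add_mul]
    refine add_le_add (add_le_add ?_ ?_) ?_
    · exact mul_le_mul hpK hE2 (sq_nonneg _) (by positivity)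
    · exact mul_le_mul hKQ hE3 (Real.exp_pos _).le hKQ10
    · exact mul_le_mul hwz' hE2 (sq_nonneg _) (by positivity)
  refine hmain.trans ?_
  rw [hnorm, hnmc, habs, hBf]
  refine reorder_le ?_ hF0 (Real.exp_pos _).le
  refine bracket_le ?_ ?_ ?_ ?_ ?_ ?_ ?_ ?_ ?_ ?_ ?_ ?_
  · exact hexp
  · positivity
  · exact ht0.le
  · exact Finset.sum_nonneg fun ν _ => hβ.le.trans (le_add_of_nonneg_left (by positivity))
  · exact Finset.sum_nonneg fun ν _ => hβ.le.trans (le_add_of_nonneg_left (by positivity))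
  · rw [Finset.mul_sum]
    calc _ ≤ ∑ _ν : Fin d, C₁ := Finset.sum_le_sum fun ν _ => htC ν
      _ = (d : ℝ) * C₁ := by rw [Finset.sum_const, Finset.card_univ, Fintype.card_fin, nsmul_eq_mul]
  · rw [Finset.mul_sum]
    calc _ ≤ ∑ _ν : Fin d, C₁ := Finset.sum_le_sum fun ν _ => htC ν
      _ = (d : ℝ) * C₁ := by rw [Finset.sum_const, Finset.card_univ, Fintype.card_fin, nsmul_eq_mul]
  · exact mul_le_mul_of_nonneg_left (add_le_add (add_le_add hcP le_rfl) (mul_le_mul_of_nonneg_left hWle (Nat.cast_nonneg d))) ht0.le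
  · rw [mul_div_assoc]; exact mul_le_mul_of_nonneg_left hQle ht0.le
  · exact hBE
  · exact hX1
  · exact hP10

end Closed

end Literature.MathematicalPhysics.QuantumFieldTheory.Balaban1983to89.B9Eq326LocalPartTowerDivergenceRowDiagonalClosed

end
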